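import Mathlib

/-!
# Wirtinger's inequality for periodic functions with zero mean

For a continuously differentiable `1`-periodic function `f : ℝ → ℂ` (i.e. `f(1) = f(0)` on the
period `[0, 1]`) with `∫_0^1 f = 0`,

  `4π² ∫_0^1 |f|² ≤ ∫_0^1 |f'|²`,

with equality exactly for `f(x) = a e(x) + b e(-x)`. Proof by Parseval on `[0, 1]`
(Mathlib's `hasSum_sq_fourierCoeffOn`) and the relation `c_n(f') = 2πi n c_n(f)`
(`fourierCoeffOn_of_hasDerivAt`), `c_0(f) = ∫_0^1 f = 0`: then
`Σ |c_n(f')|² = Σ 4π²n² |c_n(f)|² ≥ 4π² Σ |c_n(f)|²`. This is the inequality used in Roelcke's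
proof of `λ₁ ≥ 3π²/2` for the modular group (Iwaniec, *Spectral Methods of Automorphic Forms*,
proof of Theorem 11.4: "`∫_0^B |(y∇)u|² dμ ≥ B ∫ Σ_{n≠0} |2πn c_n(y)|² dy`"), where the cusp form
has vanishing zero-th Fourier coefficient. Everything here is proved.

## References
* G. H. Hardy, J. E. Littlewood, G. Pólya, *Inequalities*, 2nd ed., CUP 1952, §7.7, Thm 258
  (Wirtinger's inequality).
* H. Iwaniec, *Spectral Methods of Automorphic Forms*, 2nd ed., GSM 53, AMS 2002, proof of
  Thm 11.4, PDF pp. 121–122.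
-/

noncomputable section

open MeasureTheory Set Filter Real Complex
open scoped Topology ComplexConjugate

namespace Literature.Analysis.Fourier

/-- A continuous function is square integrable on `(0, 1]`. [folklore] -/
theorem memLp_two_Ioc_of_continuous {f : ℝ → ℂ} (hf : Continuous f) :
    MemLp f 2 (volume.restrict (Ioc (0 : ℝ) 1)) := by
  obtain ⟨C, hC⟩ := (isCompact_Icc (a := (0 : ℝ)) (b := 1)).exists_bound_of_continuousOn hf.continuousOn
  haveI : IsFiniteMeasure (volume.restrict (Ioc (0 : ℝ) 1)) := by infer_instance
  have htop : MemLp f ⊤ (volume.restrict (Ioc (0 : ℝ) 1)) := by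
    refine memLp_top_of_bound hf.aestronglyMeasurable C ?_
    rw [ae_restrict_iff' measurableSet_Ioc]
    exact Eventually.of_forall fun x hx => hC x (Ioc_subset_Icc_self hx)
  exact htop.mono_exponent le_top

/-- The zero-th Fourier coefficient on `[0, 1]` is the mean. [folklore] -/
theorem fourierCoeffOn_zero (f : ℝ → ℂ) :
    fourierCoeffOn zero_lt_one f 0 = ∫ x in (0 : ℝ)..1, f x := by
  rw [fourierCoeffOn_eq_integral]
  simp

/-- **The Fourier coefficients of the derivative**: for `f` differentiable with continuous
derivative `f'` and `f(1) = f(0)`, `c_n(f') = 2πi n · c_n(f)` on `[0, 1]` (`n ≠ 0`). [folklore] -/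
theorem fourierCoeffOn_deriv {f f' : ℝ → ℂ} (hf : ∀ x, HasDerivAt f (f' x) x) (hf' : Continuous f')
    (hper : f 1 = f 0) {n : ℤ} (hn : n ≠ 0) :
    fourierCoeffOn zero_lt_one f' n = (2 * π * Complex.I * n) * fourierCoeffOn zero_lt_one f n := by
  have h := fourierCoeffOn_of_hasDerivAt zero_lt_one hn (fun x _ => hf x) (hf'.intervalIntegrable _ _)
  rw [hper, sub_self, mul_zero, zero_sub] at h
  rw [h]
  have hI : Complex.I ≠ 0 := Complex.I_ne_zero
  have hπ : (π : ℂ) ≠ 0 := by exact_mod_cast Real.pi_ne_zero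
  have hn' : (n : ℂ) ≠ 0 := by exact_mod_cast hn
  push_cast
  field_simp
  ring

/-- **Wirtinger's inequality** (zero-mean form): for `f : ℝ → ℂ` with continuous derivative `f'`,
`f(1) = f(0)` and `∫_0^1 f = 0`, `4π² ∫_0^1 |f|² ≤ ∫_0^1 |f'|²`. [folklore] -/
theorem wirtinger {f f' : ℝ → ℂ} (hf : ∀ x, HasDerivAt f (f' x) x) (hf' : Continuous f')
    (hper : f 1 = f 0) (hmean : ∫ x in (0 : ℝ)..1, f x = 0) :
    4 * π ^ 2 * ∫ x in (0 : ℝ)..1, ‖f x‖ ^ 2 ≤ ∫ x in (0 : ℝ)..1, ‖f' x‖ ^ 2 := by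
  have hfc : Continuous f := continuous_iff_continuousAt.mpr fun x => (hf x).continuousAt
  have Pf := hasSum_sq_fourierCoeffOn zero_lt_one (memLp_two_Ioc_of_continuous hfc)
  have Pf' := hasSum_sq_fourierCoeffOn zero_lt_one (memLp_two_Ioc_of_continuous hf')
  simp only [sub_zero, inv_one, one_smul] at Pf Pf'
  have hterm : ∀ n : ℤ, 4 * π ^ 2 * ‖fourierCoeffOn zero_lt_one f n‖ ^ 2 ≤
      ‖fourierCoeffOn zero_lt_one f' n‖ ^ 2 := by
    intro n
    by_cases hn : n = 0
    · subst hn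
      rw [fourierCoeffOn_zero f, hmean, norm_zero]
      simp only [ne_eq, OfNat.ofNat_ne_zero, not_false_eq_true, zero_pow, mul_zero]
      exact sq_nonneg _
    · rw [fourierCoeffOn_deriv hf hf' hper hn, norm_mul]
      have hnorm : ‖(2 * π * Complex.I * n : ℂ)‖ = 2 * π * |(n : ℝ)| := by
        rw [norm_mul, norm_mul, norm_mul, Complex.norm_I, mul_one, Complex.norm_intCast,
          Complex.norm_real, Real.norm_of_nonneg Real.pi_pos.le, Complex.norm_two]
      rw [hnorm, mul_pow]
      have h1 : (1 : ℝ) ≤ |(n : ℝ)| := by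
        rw [← Int.cast_abs]; exact_mod_cast Int.one_le_abs hn
      have h2 : (2 * π) ^ 2 ≤ (2 * π * |(n : ℝ)|) ^ 2 := by
        apply pow_le_pow_left₀ (by positivity)
        nlinarith [Real.pi_pos]
      have h0 : 0 ≤ ‖fourierCoeffOn zero_lt_one f n‖ ^ 2 := sq_nonneg _
      nlinarith
  exact hasSum_le hterm (Pf.mul_left (4 * π ^ 2)) Pf'

end Literature.Analysis.Fourier

end
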